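import Summits.BirchSwinnertonDyer.Rank1Residual.Supersingular.X6VisibilityTamDefectRecordsB
import Summits.BirchSwinnertonDyer.Rank1Residual.Supersingular.LocalOddTorsionAdicCompletionAt
import Summits.BirchSwinnertonDyer.Rank1Residual.Supersingular.X7SevenCongruenceCertificatesB
import HarnessLib

/-!
# N4 (X6 ∧ `r_an = 0`) by VISIBILITY at `p = 7` — a SECOND per-pair route for `270618c1 @ 7` from its LEVEL-LOWERED `7`-congruent
# rank-2 partner `7314a1` (`N_F = N/37`), the congruence PROVED in the kernel (Fisher's `X_E(7)`), every local binder PROVED in the kernel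

Cell `b2b-bsdres`, supersingular family, prover A = unit `b2b-bsdres-x10b` (gen 25).  Topic file; namespace
`Summit.BirchSwinnertonDyer.Rank1Residual.Supersingular`.  THEOREMS ONLY; no named fact introduced; nothing booked; X6 stays
CONSTRUCTION-SHAPED (RESIDUAL-MAP §I N4 unchanged: the cell `270618c1 @ 7` already carries the Kurihara offer `bsdp_x6r0t_270618c1_7`
and its twins; this file is an INDEPENDENT second route — visibility + Wuthrich + Cassels–Tate instead of Kim's Kurihara-number theorem).
Shape: `X6RankZero.bsdp_of_casselsTate_of_congr_of_places` (`X6VisibilityTamDefectRecordsB.lean`, x10b gen 15).  What is new w.r.t. the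
`p = 5` X6 visibility records: (1) `p = 7`; (2) the partner is the DB-partner census (kit j156242) curve `7314a1` of conductor
`7314 = 270618/37` — Ribet level-LOWERING at `37` (`v₃₇(Δ_E) = 7`, so `ρ̄_{E,7}` is unramified at `37`; `E` non-split multiplicative, `F`
good there: a place of kind (i) since `#F(ℚ₃₇)[7] = 1`); (3) the `7`-congruence `θ : F[7] ≃ E[7]` is NOT a binder: it is the kernel
certificate `sevenCongruent_x6_270618c1_7314a1_7` (`X7SevenCongruenceCertificatesB.lean`: the rational point
`P = (−221380027141 : 1863607 : 78)` of Fisher's `X_E(7)`, `E_P ≅ F` over `ℚ` by `u = 1132252326854926538665939697664/13`, `decide +kernel`),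
modulo the named PUBLISHED fact `hF7 : thm48_sevenCongruent_twistQuartic7` (Fisher 2014 Thm. 4.8); (4) every local torsion binder
`#F(ℚ_ℓ)[7] = 1` (`ℓ = 2, 3, 23, 37, 53` and the PAID place `7`) is PROVED IN PLACE by the kernel decider (`LocalOddTorsionAdicCompletionAt`,
certificates of gen 23's `oddtors_cert.py`: empty at `2, 3, 7, 23, 53`; `[(7,0,1,0),(8,0,1,0),(12,0,1,0)]` at `37`).  Places: `2` nn/nn,
`3` nn/nn, `23` nn/ss, `53` ss/ss, `37` E nonsplit / F good — all kind (i); `7` good supersingular for BOTH (`#Ẽ(𝔽₇) = #F̃(𝔽₇) = 8`),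
PAID: `7·#F(ℚ₇)[7] = 7 < 49 ≤ 7^{rank F}`.  BINDERS LEFT: the named facts `hCT hW hGZK hmod hU hU2 hF7`; the models `hWeq`/`hFeq`; Cremona's
`r_an = 0` (`hr0`) and `ord₇ #Ш_an ≤ 2` (`hq`/`hv`; `#Ш_an = 49`); `rank F ≥ 2` (`hrank`; Cremona: rank 2, generators independent mod 7 by
reduction at 11, 13 — kit j156242).  Per pair (an OFFER for referee A); NOT a class theorem; nothing booked.

HONEST FRAMING (run/shared/lean/b2b/bsd-rank1-residual/, verbatim in every file): the goal of the cell is to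
DELETE the COMBINATION-SHAPED residual classes of the Birch–Swinnerton-Dyer formula for ALL analytic-rank `≤ 1`
elliptic curves over `ℚ` — "full BSD formula for every rank `≤ 1` curve in class `C`" assembled STRICTLY from
published theorems — so that the rank-`≤ 1` remainder becomes exactly the CONSTRUCTION-SHAPED classes, which are
TYPED (missing-input `Prop`s), NOT attempted.  This is not "finishing BSD".

References: Cremona–Mazur 2000 §3 [CremonaMazur2000]; Wuthrich 2014 Prop. 21 [Wuthrich2014]; Fisher 2014 Thm. 3.9/4.6/4.8
[Fisher2014SevenElevenCongruent]; Ribet 1990 (level lowering) [Ribet1990]; Silverman AEC VII.5.1, X.4.14 [SilvermanAEC2009]; ATAEC V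
[SilvermanATAEC1994]; Cremona's tables [Cremona2006]; HOME/b2b-bsdres-x10b/X6-KURIHARA.md §25, X7-KURIHARA.md §28.
-/

set_option autoImplicit false

noncomputable section

open scoped Classical

open WeierstrassCurve Literature.NumberTheory.EllipticCurves
  Literature.NumberTheory.EllipticCurves.Rank1Residual
  Literature.NumberTheory.EllipticCurves.Rank1Residual.Typed
  Literature.NumberTheory.EllipticCurves.Rank1Residual.X11RankOneCertificates
  Literature.NumberTheory.EllipticCurves.Wuthrich2014
  Literature.NumberTheory.EllipticCurves.Fisher2014
  Summit.BirchSwinnertonDyer.BirchSwinnertonDyer.Rank1Residual.IntModel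
  Summit.BirchSwinnertonDyer.Rank1Residual.X11b
open NumberField IsDedekindDomain Rat.HeightOneSpectrum
open Summit.BirchSwinnertonDyer.Rank1Residual.Supersingular.LocalOddTorsion

namespace Summit.BirchSwinnertonDyer.Rank1Residual.Supersingular

/-! ### `270618c1 @ 7` (X6 ∧ `r_an = 0`, `#Ш_an = 7²`, `∏c` prime to `7`) ← `7314a1` (Cremona, rank 2, conductor `7314 = N/37`) -/

/-- `270618c1` (Cremona's minimal model) is an elliptic curve: `Δ = −2⁹·3¹¹·23²·37⁷·53 ≠ 0`. [cite: Cremona2006, Table 1 (Cremona label 270618c1)] -/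
theorem isElliptic_c270618c1 : (⟨1, 1, 0, -321619873, -2220308188619⟩ : WeierstrassCurve ℚ).IsElliptic :=
  isElliptic_of_discOf_ne_zero 1 1 0 (-321619873) (-2220308188619) (by decide +kernel)

/-- `270618c1` is globally minimal (Kraus' bounded criterion, kernel; `|Δ| < 512¹²`). [cite: SilvermanAEC2009, VII.1 Remark 1.1] -/
theorem isGloballyMinimal_c270618c1 :
    (⟨1, 1, 0, -321619873, -2220308188619⟩ : WeierstrassCurve ℚ).IsGloballyMinimal :=
  isGloballyMinimal_of_krausCriterion_bounded₂ 1 1 0 (-321619873) (-2220308188619) (by decide +kernel)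
    (by decide +kernel) (by decide +kernel)

/-- The partner `7314a1` (Cremona's minimal model) is an elliptic curve: `Δ = −2²·3²·23·53 ≠ 0`.
[cite: Cremona2006, Table 1 (Cremona label 7314a1)] -/
theorem isElliptic_c7314a1 : (⟨1, 1, 0, -3, 9⟩ : WeierstrassCurve ℚ).IsElliptic :=
  isElliptic_of_discOf_ne_zero 1 1 0 (-3) 9 (by decide +kernel)

/-- The partner `7314a1` is globally minimal (Kraus' bounded criterion, kernel). [cite: SilvermanAEC2009, VII.1 Remark 1.1] -/
theorem isGloballyMinimal_c7314a1 : (⟨1, 1, 0, -3, 9⟩ : WeierstrassCurve ℚ).IsGloballyMinimal :=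
  isGloballyMinimal_of_krausCriterion_bounded₂ 1 1 0 (-3) 9 (by decide +kernel) (by decide +kernel) (by decide +kernel)

/-- `#Ẽ(𝔽₇) = 8` for `270618c1` (`a₇ = 0`: good SUPERSINGULAR at `7`; kernel count). [folklore] -/
theorem card_c270618c1_7 :
    Nat.card (((⟨1, 1, 0, -321619873, -2220308188619⟩ : WeierstrassCurve ℤ).map
      (Int.castRingHom (ZMod 7))).toAffine.Point) = 8 :=
  haveI : Fact (Nat.Prime 7) := ⟨by norm_num⟩
  natCard_point_eq_of_countPoints 1 1 0 (-321619873) (-2220308188619) 7 (by norm_num) (by decide +kernel)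
    (by decide +kernel)

/-- **`BSD(E,7)` for `270618c1` by VISIBILITY (second route; the `7`-congruence and every local binder PROVED in the kernel).**
N4 cell (class X6: semistable, good supersingular at `7`, `r_an = 0`, `#Ш_an = 7²`, `∏c` prime to `7`) from PUBLISHED theorems —
Cassels–Tate (`hCT`), Wuthrich 2014 Prop. 21 (`hW`), GZK (`hGZK`), modularity (`hmod`), Tate uniformisation (`hU`, `hU2`), Fisher 2014 Thm. 4.8
(`hF7`) — and a VISIBLE `(ℤ/7)² ⊂ Ш(E)` explained by the `7`-CONGRUENT RANK-2 curve `F = 7314a1` (Cremona; conductor `N/37`, Ribet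
level-lowering at `37`).  KERNEL: minimality of both models, `ClassX6 E 7` (`classX7`'s twin `classX6_of_intModel`), good reduction of both
curves off `S = {2, 3, 7, 23, 37, 53}` (discriminant supports `2⁹·3¹¹·23²·37⁷·53` / `2²·3²·23·53`), the congruence
`θ : F[7] ≃ E[7]` (`sevenCongruent_x6_270618c1_7314a1_7 hF7`), the local counts `#F(ℚ_ℓ)[7] = 1` at `ℓ = 2, 3, 23, 37, 53` (kind (i))
and at the PAID place `7` (decider + bridge, `decide +kernel`).  Displayed: `hr0`, `hq`/`hv` (Cremona's `r_an = 0`, `ord₇ #Ш_an ≤ 2`),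
`hrank : 2 ≤ rank F` (Cremona).  Per pair (an OFFER for referee A); NOT a class theorem; nothing booked.
[cite: Wuthrich2014, Prop. 21 (p. 400)] [cite: CremonaMazur2000, §3 and Table 1] [cite: Fisher2014SevenElevenCongruent, Thm. 4.8]
[cite: SilvermanAEC2009, VII.5 Prop. 5.1 and Thm. X.4.14] [cite: Cremona2006, Table 1 (Cremona labels 270618c1, 7314a1)] -/
theorem bsdp_x6r0vis7_270618c1_7
    (hCT : exists_casselsTate_pairing (K := ℚ)) (hW : sha_dvd_analyticSha)
    (hGZK : rank_eq_analyticRank_of_analyticRank_le_one) (hmod : hasEntireLFunction_rat)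
    (hU : Silverman1994_thmV53_tateUniformisation.{0})
    (hU2 : Silverman1994_thmV53_corV54_tateUniformisation.{0})
    (hF7 : thm48_sevenCongruent_twistQuartic7)
    {W F : WeierstrassCurve ℚ} [W.IsElliptic] [W.IsGloballyMinimal] [F.IsElliptic] [F.IsGloballyMinimal]
    (hWeq : W = ⟨1, 1, 0, -321619873, -2220308188619⟩) (hFeq : F = ⟨1, 1, 0, -3, 9⟩)
    (hr0 : W.analyticRank = 0) {q : ℚ} (hq : shaAn W = (q : ℂ)) (hv : padicValRat 7 q ≤ 2)
    (hrank : 2 ≤ F.mordellWeilRank) :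
    BSDp W 7 := by
  haveI : Fact (Nat.Prime 7) := ⟨by norm_num⟩
  -- the 7-congruence from the kernel certificate on X_E(7)
  obtain ⟨θ, hθ⟩ := sevenCongruent_x6_270618c1_7314a1_7 hF7 hWeq hFeq
  -- the local torsion counts #F(ℚ_ℓ)[7] = 1, proved in place by the kernel decider
  have h2 : ∀ w : HeightOneSpectrum (𝓞 ℚ), (primesEquiv w : ℕ) = 2 →
      Nat.card (nsmulAddMonoidHom 7 : (F.baseChange (w.adicCompletion ℚ)).toAffine.Point →+ _).ker = 1 := by
    intro w hw
    haveI : Fact (Nat.Prime 2) := ⟨by norm_num⟩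
    refine natCard_ker_nsmul_seven_adicCompletion_eq_one_of_checkAt 2 1 1 0 (-3) 9 (by decide +kernel)
      (k := 1) (cert := []) (by decide +kernel) F ?_ hw
    rw [hFeq]; ext <;> norm_num
  have h3 : ∀ w : HeightOneSpectrum (𝓞 ℚ), (primesEquiv w : ℕ) = 3 →
      Nat.card (nsmulAddMonoidHom 7 : (F.baseChange (w.adicCompletion ℚ)).toAffine.Point →+ _).ker = 1 := by
    intro w hw
    haveI : Fact (Nat.Prime 3) := ⟨by norm_num⟩
    refine natCard_ker_nsmul_seven_adicCompletion_eq_one_of_checkAt 3 1 1 0 (-3) 9 (by decide +kernel)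
      (k := 1) (cert := []) (by decide +kernel) F ?_ hw
    rw [hFeq]; ext <;> norm_num
  have h7 : ∀ w : HeightOneSpectrum (𝓞 ℚ), (primesEquiv w : ℕ) = 7 →
      Nat.card (nsmulAddMonoidHom 7 : (F.baseChange (w.adicCompletion ℚ)).toAffine.Point →+ _).ker = 1 := by
    intro w hw
    refine natCard_ker_nsmul_seven_adicCompletion_eq_one_of_checkAt 7 1 1 0 (-3) 9 (by decide +kernel)
      (k := 1) (cert := []) (by decide +kernel) F ?_ hw
    rw [hFeq]; ext <;> norm_num
  have h23 : ∀ w : HeightOneSpectrum (𝓞 ℚ), (primesEquiv w : ℕ) = 23 →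
      Nat.card (nsmulAddMonoidHom 7 : (F.baseChange (w.adicCompletion ℚ)).toAffine.Point →+ _).ker = 1 := by
    intro w hw
    haveI : Fact (Nat.Prime 23) := ⟨by norm_num⟩
    refine natCard_ker_nsmul_seven_adicCompletion_eq_one_of_checkAt 23 1 1 0 (-3) 9 (by decide +kernel)
      (k := 1) (cert := []) (by decide +kernel) F ?_ hw
    rw [hFeq]; ext <;> norm_num
  have h37 : ∀ w : HeightOneSpectrum (𝓞 ℚ), (primesEquiv w : ℕ) = 37 →
      Nat.card (nsmulAddMonoidHom 7 : (F.baseChange (w.adicCompletion ℚ)).toAffine.Point →+ _).ker = 1 := by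
    intro w hw
    haveI : Fact (Nat.Prime 37) := ⟨by norm_num⟩
    refine natCard_ker_nsmul_seven_adicCompletion_eq_one_of_checkAt 37 1 1 0 (-3) 9 (by decide +kernel)
      (k := 1) (cert := [((7 : ℤ), 0, 1, 0), ((8 : ℤ), 0, 1, 0), ((12 : ℤ), 0, 1, 0)]) (by decide +kernel) F ?_ hw
    rw [hFeq]; ext <;> norm_num
  have h53 : ∀ w : HeightOneSpectrum (𝓞 ℚ), (primesEquiv w : ℕ) = 53 →
      Nat.card (nsmulAddMonoidHom 7 : (F.baseChange (w.adicCompletion ℚ)).toAffine.Point →+ _).ker = 1 := by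
    intro w hw
    haveI : Fact (Nat.Prime 53) := ⟨by norm_num⟩
    refine natCard_ker_nsmul_seven_adicCompletion_eq_one_of_checkAt 53 1 1 0 (-3) 9 (by decide +kernel)
      (k := 1) (cert := []) (by decide +kernel) F ?_ hw
    rw [hFeq]; ext <;> norm_num
  have hIW : integralModelInt W = ⟨1, 1, 0, -321619873, -2220308188619⟩ :=
    integralModelInt_eq_of_map_eq _ (by rw [hWeq]; ext <;> simp [WeierstrassCurve.map])
  -- class X6 at 7 for the target
  have hX : ClassX6 W 7 :=
    classX6_of_intModel 7 (by norm_num) hIW (by decide +kernel) card_c270618c1_7 (by decide) (by decide +kernel)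
  -- the prime lists: every prime divisor of Δ_E, Δ_F lies in L
  set L : List ℕ := [2, 3, 7, 23, 37, 53] with hL
  have hLp : ∀ r ∈ L, r.Prime := by decide
  have hΔE : ∀ r : ℕ, r.Prime → (r : ℤ) ∣ (⟨1, 1, 0, -321619873, -2220308188619⟩ : WeierstrassCurve ℤ).Δ → r ∈ L :=
    forall_mem_of_natAbs_eq_prod_pow L [9, 11, 0, 2, 7, 1] hLp (by decide +kernel)
  have hΔF : ∀ r : ℕ, r.Prime → (r : ℤ) ∣ (⟨1, 1, 0, -3, 9⟩ : WeierstrassCurve ℤ).Δ → r ∈ L :=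
    forall_mem_of_natAbs_eq_prod_pow L [2, 2, 0, 1, 0, 1] hLp (by decide +kernel)
  -- the sets of places S (over L) and T (over 7)
  set e := primesEquiv (R := 𝓞 ℚ) with he
  set v₇ : HeightOneSpectrum (𝓞 ℚ) := e.symm ⟨7, Fact.out⟩ with hv₇def
  have hv₇ : (e v₇ : ℕ) = 7 := by rw [hv₇def, Equiv.apply_symm_apply]
  have heq7 : ∀ w : HeightOneSpectrum (𝓞 ℚ), (e w : ℕ) = 7 → w = v₇ := by
    intro w hw
    have h1 : e w = ⟨7, Fact.out⟩ := Subtype.ext hw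
    rw [hv₇def, ← h1, Equiv.symm_apply_apply]
  set S : Finset (HeightOneSpectrum (𝓞 ℚ)) :=
    (L.filterMap fun r ↦ if h : r.Prime then some (e.symm ⟨r, h⟩) else none).toFinset with hSdef
  have hmemS : ∀ w : HeightOneSpectrum (𝓞 ℚ), w ∈ S ↔ (e w : ℕ) ∈ L := by
    intro w
    rw [hSdef, List.mem_toFinset, List.mem_filterMap]
    constructor
    · rintro ⟨r, hr, hrw⟩
      by_cases hrp : r.Prime
      · rw [dif_pos hrp, Option.some.injEq] at hrw
        rw [← hrw, Equiv.apply_symm_apply]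
        exact hr
      · rw [dif_neg hrp] at hrw
        exact absurd hrw (by simp)
    · intro hw
      refine ⟨(e w : ℕ), hw, ?_⟩
      rw [dif_pos (e w).2]
      simp
  set T : Finset (HeightOneSpectrum (𝓞 ℚ)) := {v₇} with hTdef
  have hTS : T ⊆ S := by
    intro w hw
    rw [hTdef, Finset.mem_singleton] at hw
    rw [hmemS, hw, hv₇]; decide
  -- good reduction outside S
  have hS : ∀ w : HeightOneSpectrum (𝓞 ℚ), w ∉ S →
      W.HasGoodReductionAt w ∧ F.HasGoodReductionAt w ∧ ((7 : ℕ) : 𝓞 ℚ) ∉ w.asIdeal := by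
    intro w hwS
    have hwL : (e w : ℕ) ∉ L := fun h ↦ hwS ((hmemS w).mpr h)
    have hqp : (e w : ℕ).Prime := (e w).2
    refine ⟨?_, ?_, natCast_not_mem_of_primesEquiv_ne w Fact.out fun h ↦ hwL ?_⟩
    · rw [hWeq]; exact hasGoodReductionAt_mk_of_primesEquiv _ _ _ _ _ w rfl fun h ↦ hwL (hΔE _ hqp h)
    · rw [hFeq]; exact hasGoodReductionAt_mk_of_primesEquiv _ _ _ _ _ w rfl fun h ↦ hwL (hΔF _ hqp h)
    · show (primesEquiv w : ℕ) ∈ L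
      rw [h]; decide
  -- the paid place 7: `#F(ℚ₇)[7] · #(ℤ₇/7) = 1 · 7 < 49 ≤ 7 ^ rank F`
  have hcard7 : ∏ w ∈ T, Nat.card (w.adicCompletionIntegers ℚ ⧸
      Ideal.span {((7 : ℕ) : w.adicCompletionIntegers ℚ)}) = 7 ^ Module.finrank ℚ ℚ :=
    WeierstrassCurve.prod_natCard_quot_adicCompletionIntegers (K := ℚ) (p := 7) T fun w hw h ↦
      hw (by rw [hTdef, Finset.mem_singleton]; exact heq7 w (primesEquiv_eq_of_natCast_mem Fact.out h))
  have hT : (∏ w ∈ T, Nat.card (nsmulAddMonoidHom 7 :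
        (F.baseChange (w.adicCompletion ℚ)).toAffine.Point →+ _).ker *
        Nat.card (w.adicCompletionIntegers ℚ ⧸
          Ideal.span {((7 : ℕ) : w.adicCompletionIntegers ℚ)})) < 7 ^ F.mordellWeilRank := by
    rw [Finset.prod_mul_distrib, hcard7, Module.finrank_self, hTdef, Finset.prod_singleton, h7 v₇ hv₇]
    calc (1 : ℕ) * 7 ^ 1 < 7 ^ 2 := by norm_num
      _ ≤ 7 ^ F.mordellWeilRank := Nat.pow_le_pow_right (by norm_num) hrank
  -- the free places: all of kind (i)
  have hplaces : ∀ w ∈ S, w ∉ T →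
      (((7 : ℕ) : 𝓞 ℚ) ∉ w.asIdeal ∧ Nat.card (nsmulAddMonoidHom 7 :
          (F.baseChange (w.adicCompletion ℚ)).toAffine.Point →+ _).ker = 1) ∨
      (W.HasSplitMultiplicativeReductionAt w ∧ F.HasSplitMultiplicativeReductionAt w ∧
        Nat.card (nsmulAddMonoidHom 7 :
          (W.baseChange (w.adicCompletion ℚ)).toAffine.Point →+ _).ker ≤ 7) ∨
      (W.HasMultiplicativeReductionAt w ∧ F.HasMultiplicativeReductionAt w ∧
        (∃ r : w.adicCompletion ℚ, algebraMap ℚ (w.adicCompletion ℚ) (-(W.c₄ / W.c₆)) =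
          r ^ 2 * algebraMap ℚ (w.adicCompletion ℚ) (-(F.c₄ / F.c₆))) ∧
        (∀ ζ : w.adicCompletion ℚ, ζ ^ 7 = 1 → ζ = 1)) := by
    intro w hwS hwT
    have hwL : (e w : ℕ) ∈ L := (hmemS w).mp hwS
    have hw7 : (e w : ℕ) ≠ 7 := fun h ↦ hwT (by rw [hTdef, Finset.mem_singleton]; exact heq7 w h)
    have hcases : (e w : ℕ) = 2 ∨ (e w : ℕ) = 3 ∨ (e w : ℕ) = 23 ∨ (e w : ℕ) = 37 ∨ (e w : ℕ) = 53 := by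
      simp only [hL, List.mem_cons, List.mem_nil_iff, or_false] at hwL
      omega
    rcases hcases with hw | hw | hw | hw | hw
    · exact Or.inl ⟨natCast_not_mem_of_primesEquiv_ne w Fact.out hw7, h2 w hw⟩
    · exact Or.inl ⟨natCast_not_mem_of_primesEquiv_ne w Fact.out hw7, h3 w hw⟩
    · exact Or.inl ⟨natCast_not_mem_of_primesEquiv_ne w Fact.out hw7, h23 w hw⟩
    · exact Or.inl ⟨natCast_not_mem_of_primesEquiv_ne w Fact.out hw7, h37 w hw⟩
    · exact Or.inl ⟨natCast_not_mem_of_primesEquiv_ne w Fact.out hw7, h53 w hw⟩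
  exact X6RankZero.bsdp_of_casselsTate_of_congr_of_places hCT hW hGZK hmod hU hU2 W 7 (by norm_num) hX hr0 hq hv F θ hθ
    S T hTS hS hT hplaces

end Summit.BirchSwinnertonDyer.Rank1Residual.Supersingular

end
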